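import Mathlib
import Summits.Ventures.HodgeRepro.Tier4.Target
import Summits.Ventures.HodgeRepro.Tier4.Line3.Defs
import Summits.Ventures.HodgeRepro.Tier4.Line3.DefsLemmas
import Summits.Ventures.HodgeRepro.Tier4.Line3.GaussRatioFormula
import Summits.Ventures.HodgeRepro.Tier4.Line3.CopyRemainder
import Summits.Ventures.HodgeRepro.Tier4.Line3.CopyWeightGaussian
import Summits.Ventures.HodgeRepro.Tier4.Line3.CopyWeightBoundShrink
import Summits.Ventures.HodgeRepro.Tier4.Line3.LatticeGaussSummable
import Summits.Ventures.HodgeRepro.Tier4.Line3.CopyCountSummable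
import Summits.Ventures.HodgeRepro.Tier4.Line3.ShrinkMajGauss

/-!
# Tier4/Line3/CopyCountShrink — the `Summable` half of the pure count for the shrinking majorant, on the natural data

Blind re-derivation cell `pub-hodge-repro`, Tier 4 «PROVE THE STEP», LINE L3, seat t4-x2 (g3, reserve wall-breaker).
Assembly of ShrinkMajGauss (the majorant `shrinkMaj A k (rep o) xm` of CopyWeightBoundShrink is Gaussian in the houses of
integral scalars once every definite size of the centre is positive) and CopyCountSummable (a Gaussian-dominated count over
the copies is summable):

* `defQuad_pos`: at a definite embedding the definite size of a non-zero vector is positive (`IsDefinite`, `hDef`);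
  `exists_defQuad_lower`: a positive lower bound of all definite sizes of a centre with non-zero slots;
* **`summable_copyCount_shrinkMaj`**: for integral admissible scalars, a centre with non-zero slots, `A ≥ 0`, `k ≥ 0` and
  phases bounded by `Λ₀` on the copies (`Λ₀ ≥ 0` is automatic from any copy; not assumed),
  `Summable (fun o => if o ∈ Copies S xm ∧ o ≠ main then shrinkMaj A k (c.rep o) xm * ‖Λ(o)‖ else 0)`
  — the `Summable` conjunct of v0.44's `MajorantCount S xm (c.majHK A k) θ₁` (bus S13913) as a THEOREM.

What stays displayed in the count: the inequality `Σ' ≤ θ₁` (the profile condition of the centre, bus S13860 (F2); along the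
integer ray it is GaussCountRay's Tannery statement under the strict profile condition), and the phase bound `‖Λ(o)‖ ≤ Λ₀`
(unimodular on unit scalars; a sub-Gaussian version would do for the general natural scalars).

Nothing here says anything about the status of the Hodge conjecture for CM abelian varieties, which is NOT proved
(HC_CM is NOT proved by anyone in this repository).
-/

set_option autoImplicit false

noncomputable section

namespace Summit.Ventures.HodgeRepro.Tier4.Line3

open Summit.Ventures.HodgeRepro.Tier4
open Matrix NumberField
open scoped ComplexConjugate
open scoped Classical

namespace T4Data

variable (X : T4Data)

/-- The `σ`-image of a non-zero vector is non-zero. -/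
theorem emb_vec_ne_zero (σ : X.E →+* ℂ) {x : Fin 3 → X.E} (hx : x ≠ 0) : (fun i => σ (x i)) ≠ 0 := by
  intro h
  apply hx
  funext i
  have := congrFun h i
  simpa using this

/-- **THE DEFINITE SIZE OF A NON-ZERO VECTOR IS POSITIVE** at a definite embedding. -/
theorem defQuad_pos {σ : X.E →+* ℂ} (hσ : σ ∈ X.defEmb) {x : Fin 3 → X.E} (hx : x ≠ 0) : 0 < X.defQuad σ x := by
  have hσ' : σ ≠ X.τ₀ ∧ σ ≠ conjEmb X.τ₀ := by
    simpa only [defEmb, Finset.mem_filter, Finset.mem_univ, true_and] using hσ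
  have hdef : IsDefinite (X.H.map σ) := X.hDef σ hσ'.1 hσ'.2
  have hv : (fun i => σ (x i)) ≠ 0 := X.emb_vec_ne_zero σ hx
  unfold defQuad
  rcases hdef with hpos | hneg
  · exact abs_pos.2 (hpos.re_dotProduct_pos hv).ne'
  · have h := hneg.re_dotProduct_pos hv
    rw [Matrix.neg_mulVec, dotProduct_neg, map_neg] at h
    have h2 : ((star (fun i => σ (x i)) ⬝ᵥ (X.H.map σ *ᵥ fun i => σ (x i)))).re < 0 := by
      have hre : RCLike.re ((star (fun i => σ (x i)) ⬝ᵥ (X.H.map σ *ᵥ fun i => σ (x i)))) =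
          ((star (fun i => σ (x i)) ⬝ᵥ (X.H.map σ *ᵥ fun i => σ (x i)))).re := rfl
      linarith
    exact abs_pos.2 h2.ne

/-- A positive lower bound of all the definite sizes of a centre with non-zero slots. -/
theorem exists_defQuad_lower (xm : X.Tuple) (hx : ∀ j, xm j ≠ 0) :
    ∃ qm : ℝ, 0 < qm ∧ ∀ j, ∀ σ ∈ X.defEmb, qm ≤ X.defQuad σ (xm j) := by
  by_cases hne : (Finset.univ ×ˢ X.defEmb : Finset (Fin 4 × (X.E →+* ℂ))).Nonempty
  · obtain ⟨p, hp, hmin⟩ := Finset.exists_min_image _ (fun p : Fin 4 × (X.E →+* ℂ) => X.defQuad p.2 (xm p.1)) hne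
    refine ⟨X.defQuad p.2 (xm p.1), X.defQuad_pos (Finset.mem_product.1 hp).2 (hx p.1), fun j σ hσ => ?_⟩
    exact hmin (j, σ) (Finset.mem_product.2 ⟨Finset.mem_univ j, hσ⟩)
  · refine ⟨1, one_pos, fun j σ hσ => ?_⟩
    exact absurd ⟨(j, σ), Finset.mem_product.2 ⟨Finset.mem_univ j, hσ⟩⟩ hne

/-- The shrinking majorant is non-negative for `A ≥ 0`. -/
theorem shrinkMaj_nonneg {A : ℝ} (hA : 0 ≤ A) (k : ℝ) (ε : Fin 4 → X.E) (x : X.Tuple) :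
    0 ≤ X.shrinkMaj A k ε x := by
  unfold shrinkMaj
  have h1 : 0 ≤ ∏ j, (min 1 (‖X.τ₀ (ε j)‖ ^ 2)) ^ (-k) :=
    Finset.prod_nonneg fun j _ => Real.rpow_nonneg (by positivity) _
  positivity

/-- **THE `Summable` HALF OF THE PURE COUNT FOR THE SHRINKING MAJORANT**, on integral admissible scalars with bounded phases. -/
theorem summable_copyCount_shrinkMaj {D : X.ThetaData} {S : Set (Fin 4 → X.E)} {xm : X.Tuple}
    (hS : X.IntegralScalars S) (hx : ∀ j, xm j ≠ 0) (c : X.CopyData D S xm) {A k : ℝ} (hA : 0 ≤ A) (hk : 0 ≤ k)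
    {Λ₀ : ℝ} (hΛ : ∀ o ∈ X.Copies S xm, ‖c.lam o 0 * c.lam o 1 * conj (c.lam o 2 * c.lam o 3)‖ ≤ Λ₀) :
    Summable fun o => if o ∈ X.Copies S xm ∧ o ≠ X.orbitOf (X.lines xm) then
      X.shrinkMaj A k (c.rep o) xm * ‖c.lam o 0 * c.lam o 1 * conj (c.lam o 2 * c.lam o 3)‖ else 0 := by
  obtain ⟨qm, hqm, hq⟩ := X.exists_defQuad_lower xm hx
  obtain ⟨C, κ, hκ, hbound⟩ := X.shrinkMaj_le_gauss A k hA hk xm hx hqm hq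
  refine X.summable_copyCount_of_gauss c hS
    (fun o => X.shrinkMaj A k (c.rep o) xm * ‖c.lam o 0 * c.lam o 1 * conj (c.lam o 2 * c.lam o 3)‖)
    (fun o => mul_nonneg (X.shrinkMaj_nonneg hA k _ _) (norm_nonneg _)) (C := C * Λ₀) hκ fun o ho _ => ?_
  have h1 := hbound (c.rep o) (fun j => hS _ (c.rep_mem o ho) j) (c.rep_ne o ho)
  have h2 := hΛ o ho
  calc X.shrinkMaj A k (c.rep o) xm * ‖c.lam o 0 * c.lam o 1 * conj (c.lam o 2 * c.lam o 3)‖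
      ≤ (C * Real.exp (-(κ * ∑ j, ‖mixedEmbedding X.E (c.rep o j)‖ ^ 2))) * Λ₀ :=
        mul_le_mul h1 h2 (norm_nonneg _) (by
          have := X.shrinkMaj_nonneg hA k (c.rep o) xm
          exact le_trans this h1)
    _ = C * Λ₀ * Real.exp (-(κ * ∑ j, ‖mixedEmbedding X.E (c.rep o j)‖ ^ 2)) := by ring

end T4Data

end Summit.Ventures.HodgeRepro.Tier4.Line3

end
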